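import Summits.QuantumFields.BalabanUV.Beta.CombHId1Sandwich
import Literature.MathematicalPhysics.QuantumFieldTheory.Balaban1983to89.Beta.SecondOrderResponse

/-!
# `BalabanUV.Beta.NVertexWoundFold` — row D1 ∕ (C1), PART 14: **THE SOURCE-WOUND CHAIN-RULE VERTEX IS THE FOLD THROUGH THE PERIODISED COLUMN, AND THE
# WOUND DOUBLE FOLD** — the two-source twin of PART 11 ∕ C2a (`CombHId1Letters.dper_vertexOfK_eq_sum`) that J-NOTE-7 says the second-order rows need

WHY (an2 g67 J-NOTE-7, journal l.67681; memo `HOME/b2b-balaban-beta-an2/gen67/J7-WINDING-OBSTRUCTION.md` §4).  The END wrapper's second-order rows read, on a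
finite torus `M = N·M′`, a tower bi-jet that is bilinear in the PERIODISED chart columns `colN̂_s(b) = Σ_k K(b + M k; N s) = (perF M K) ((b♭), (wrapPt M (N s), inr ·))`
of two lattice sources `s₁, s₂`; the lattice second-order vertex `vertex2OfK K N S₂ μ y ν y′` is bilinear in the UNPERIODISED columns.  The two agree only after
WINDING the second source over the coarse torus: this file proves, for any period-invariant decaying chart `K` and any jointly block-covariant local bi-stencil
family `S₂`, that the wound lattice kernel `x z ↦ Σ'_d vertex2OfK K N S₂ μ y ν (y′ + M′∘d) x z` periodises to the product-form double fold
`Σ_b Σ_{b′} colN̂_{(μ,y)}(b) · colN̂_{(ν,y′)}(b′) • perF M (dper M (W b′.2 b′.1 b.2 b.1))`, `W κ′ u′ κ u := Σ'_n S₂ κ u κ′ (u′ + M∘n)` the second-bond-periodised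
bi-member (leaf-02's letter) — the exact torus identity whose `d = 0` term alone v4's `hQN₂ ∕ hHN₂` display.

WHAT ([folklore] `tsum` bookkeeping BY NAME over C2a's toolkit; generic dimension `d`; no `def`, no `def … : Prop`, nothing cited, 0 sorry).
§1 ONE SOURCE WOUND: `tsum_colH_translate` (the wound column IS the periodised column: `Σ'_d K u′ (N•(y′ + M′∘d)) = perZ M K u′ (N•y′)` — `nsmul_translate` + `perZ_apply`),
**`tsum_vertexOfK_translate_apply`** (for a bond-localised family `S`, NO covariance needed:
`Σ'_d vertexOfK K N S ν (y′ + M′∘d) x z a b = Σ_{β ∈ pbox M × Fin} (perF M K) ((β.1, inl β.2), (wrapPt M (N•y′), inr ν)) · Σ'_n S β.2 (β.1 + M∘n) x z a b`).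
§2 TWO SOURCES: for `S₂` a local bi-stencil family (lit `LocStencil₂`) with JOINT block covariance, the slices are bond-localised in the second bond (`biLoc_slice`),
the second-bond-periodised slice families are period-covariant and bond-localised (`tsum_slice_translate`, `biLoc_tsum_slice`), the wound slice vertex is their
column-weighted sum (**`tsum_vertexOfK_slice_translate`**), and the wound double vertex is the chain-rule vertex over it (**`tsum_vertex2OfK_translate_apply`**).
The assembly at the matrix level (`perF_dper_tsum_vertex2OfK_translate`: the periodised wound double fold = the product-form double fold) is the sequel
`NVertexWoundFoldAssembly` (PART 14b).
WHAT THIS IS NOT: not instantiated at the N-system's `WN = W2SymOfK (AN R j) …` (its sectors `vertex2OfK ∕ mixOfK ∕ dM (K2OfK …)` are folded in the sequel on the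
road's displayed word); no row of the END wrapper discharged or refuted; nothing of Bałaban's asserted, valued or discharged; 0 estimates; 0∕4 row-D1 binders
(hW, hR, D1Tel, D1Rep); ROOT M‴ p325680 ∕ P5c ∕ D6 untouched; NOT (C1), NOT (L2′), NOT D1, NEVER «G-an2-4 closed», NOT BetaPertH, NOT continuum, NOT Clay.

HONEST DEPENDENCY (page 1, mandatory): continuum YM on T⁴ ⇐ BetaPertH ∧ nine spine estimates (0/9 proved); BetaPertH ⇐ (D1) ∧ (D4) ∧ CAP+tail;
G-an2-4 gates asym, D1 and NE2/3/4.  HONEST FRAMING (cell contract, verbatim): «discharging `BetaPertH` makes Bałaban's UV stability UNCONDITIONAL —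
a real constructive-QFT result; it is NOT the continuum limit and NOT the Clay problem.»  ABSOLUTE RULE (cell charter, verbatim): «No internally-minted
statement may enter as a cited fact. Every hypothesis is either kernel-proved in this package or a verbatim quotation of a PUBLISHED theorem with page
reference. The manuscript(s) under audit are NOT citable for their own disputed steps — they are the thing under adjudication; programme-internal
(2001/route/tribunal) claims are never citable.»  Row D1 ∕ (C1) OWNER an2 (b2b-balaban-beta-an2) gen 67, 2026-08-27.  No existing file touched.
-/

noncomputable section

open scoped BigOperators

namespace Summit.QuantumFields.BalabanUV.Beta.NVertexWoundFold

open Finset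
open Literature.MathematicalPhysics.QuantumFieldTheory.Balaban1983to89
open Literature.MathematicalPhysics.QuantumFieldTheory.Balaban1983to89.Beta
open B12Sec2to5 (l1 l1_nonneg)
open B4TorusKernel.MultiPeriod (translate translate_apply)
open B4Reflection242 (translate_translate)
open B4Sect5Proof (latticeConst latticeConst_nonneg)
open B6Lemma24Torus (pbox)
open ExpKernelCalculus (MKer Decays BiLoc shiftK summable_exp_shift l1_sub_symm)
open AffineAveraging (Site)
open OneStepResolventKernel (Fib wsum)
open OneStepKernelFamily (colH vertexOfK abs_colH_le)
open BalabanCompositeJets (LocStencil₂)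
open SecondOrderResponse (vertex2OfK biLoc_vertexOfK_slice)
open Summit.QuantumFields.BalabanUV.Beta.FP.KernelPeriodisationFib (Idx perF perF_apply perZ perZ_apply perZ_translate_left perZ_translate_right
  translate_eq_add)
open Summit.QuantumFields.BalabanUV.Beta.FP.KernelPeriodisationFibLoc (dper dper_apply summable_exp_l1_translate)
open Summit.QuantumFields.BalabanUV.Beta.FP.KernelPeriodisationFibTrace (tsum_sites_eq_sum_tsum)
open Summit.QuantumFields.BalabanUV.Beta.FP.TorusGaugeCovariancePairing (wrapPt wrapPt_coe)
open Summit.QuantumFields.BalabanUV.Beta.PeriodisedIndexLawSummable (abs_apply_le_of_biLoc)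
open Summit.QuantumFields.BalabanUV.Beta.CombHId1Letters (vertexOfK_apply perZ_eq_tsum_translate_left abs_perZ_le_of_decays summable_col_mul_family
  summable_of_translate_bound nsmul_translate perZ_coarse_col_eq_perF dper_vertexOfK_eq_sum)
open Summit.QuantumFields.BalabanUV.Beta.CombHId1Sandwich (perF_vertexOfK_dper_apply)

variable {d : ℕ} (M : Fin (d + 1) → ℕ) [∀ μ, NeZero (M μ)] {M' : Fin (d + 1) → ℕ} {N : ℕ}
  {K : MKer (d + 1) (Fib d)}

/-! ## §1 One source, wound over the coarse torus: the fold through the PERIODISED column -/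

section OneSource

variable {S : Fin (d + 1) → Site (d + 1) → MKer (d + 1) (Fib d)}

omit [∀ μ, NeZero (M μ)] in
/-- [folklore] **THE WOUND COLUMN IS THE PERIODISED COLUMN**: summing the chart's `ℋ`-column over the coarse windings `y′ + M′∘d` of its source is the torus
periodisation of the chart in its source slot (`M = N·M′`; `nsmul_translate` + `perZ_apply`). -/
theorem tsum_colH_translate (hM : ∀ i, M i = N * M' i) (ν κ' : Fin (d + 1)) (y' u' : Site (d + 1)) :
    ∑' dd : Site (d + 1), colH K N ν (translate M' y' dd) κ' u' = perZ M K u' ((N : ℤ) • y') (Sum.inl κ') (Sum.inr ν) := by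
  rw [perZ_apply]
  exact tsum_congr fun dd => by rw [colH, nsmul_translate hM]

omit [∀ μ, NeZero (M μ)] in
/-- [folklore] the wound column, term by term, re-indexed onto the family index (`K` is period-invariant):
`K u (N•(y′ + M′∘d)) = K (u + M∘(−d)) (N•y′)`. -/
theorem colH_translate_eq (hM : ∀ i, M i = N * M' i)
    (hKinv : ∀ (m x z : Site (d + 1)) (a b : Fib d), K (translate M x m) (translate M z m) a b = K x z a b)
    (ν κ' : Fin (d + 1)) (y' u : Site (d + 1)) (dd : Site (d + 1)) :
    K u ((N : ℤ) • translate M' y' dd) (Sum.inl κ') (Sum.inr ν) = K (translate M u (-dd)) ((N : ℤ) • y') (Sum.inl κ') (Sum.inr ν) := by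
  have h := hKinv (-dd) u (translate M ((N : ℤ) • y') dd) (Sum.inl κ') (Sum.inr ν)
  have e : translate M (translate M ((N : ℤ) • y') dd) (-dd) = (N : ℤ) • y' := by
    rw [translate_translate, add_neg_cancel]; funext i; simp only [translate_apply, Pi.zero_apply, mul_zero, add_zero]
  rw [e] at h
  rw [nsmul_translate hM, ← h]

/-- [folklore] Fubini for the wound column against a bond-localised family: `Σ'_d Σ'_u K (u + M∘(−d)) (N•y′) · S κ′ u x z = Σ'_u perZ M K u (N•y′) · S κ′ u x z`. -/
theorem tsum_tsum_col_translate_mul (hKinv : ∀ (m x z : Site (d + 1)) (a b : Fib d), K (translate M x m) (translate M z m) a b = K x z a b)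
    {CK δK CS δS : ℝ} (hK : Decays K CK δK) (hCK : 0 ≤ CK) (hδK : 0 < δK)
    (hS : ∀ κ u, BiLoc (S κ u) u u CS δS) (hCS : 0 ≤ CS) (hδS : 0 < δS)
    (ν κ' : Fin (d + 1)) (y' x z : Site (d + 1)) (a b : Fib d) :
    (∑' dd : Site (d + 1), ∑' u : Site (d + 1), K (translate M u (-dd)) ((N : ℤ) • y') (Sum.inl κ') (Sum.inr ν) * S κ' u x z a b)
      = ∑' u : Site (d + 1), perZ M K u ((N : ℤ) • y') (Sum.inl κ') (Sum.inr ν) * S κ' u x z a b := by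
  rw [← (Equiv.neg (Site (d + 1))).tsum_eq fun dd => ∑' u : Site (d + 1),
    K (translate M u (-dd)) ((N : ℤ) • y') (Sum.inl κ') (Sum.inr ν) * S κ' u x z a b]
  simp only [Equiv.neg_apply, neg_neg]
  have hsum := summable_col_mul_family M (N := N) hK hCK hδK hS hCS hδS κ' ν y' x z a b
  rw [hsum.tsum_comm]
  refine tsum_congr fun u => ?_
  rw [perZ_eq_tsum_translate_left M hKinv, ← tsum_mul_right]

/-- [folklore] the summability letter of the previous lemma in the wound index `d` (for the finite exchange over the fibre index). -/
theorem summable_tsum_col_translate_mul {CK δK CS δS : ℝ} (hK : Decays K CK δK) (hCK : 0 ≤ CK) (hδK : 0 < δK)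
    (hS : ∀ κ u, BiLoc (S κ u) u u CS δS) (hCS : 0 ≤ CS) (hδS : 0 < δS)
    (ν κ' : Fin (d + 1)) (y' x z : Site (d + 1)) (a b : Fib d) :
    Summable fun dd : Site (d + 1) => ∑' u : Site (d + 1), K (translate M u (-dd)) ((N : ℤ) • y') (Sum.inl κ') (Sum.inr ν) * S κ' u x z a b := by
  have hsum := (summable_col_mul_family M (N := N) hK hCK hδK hS hCS hδS κ' ν y' x z a b).prod_symm.prod
  exact (Equiv.neg (Site (d + 1))).summable_iff.2 hsum

/-- [folklore] box splitting of the periodic-weighted family sum: `Σ'_u perZ M K u (N•y′) · S κ′ u x z = Σ_{u ∈ pbox M} perZ M K u (N•y′) · Σ'_n S κ′ (u + M∘n) x z`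
(`tsum_sites_eq_sum_tsum`; `perZ` is periodic in `u` for a period-invariant `K`). -/
theorem tsum_perZ_mul_eq_sum_box (hKinv : ∀ (m x z : Site (d + 1)) (a b : Fib d), K (translate M x m) (translate M z m) a b = K x z a b)
    {CK δK CS δS : ℝ} (hK : Decays K CK δK) (hCK : 0 ≤ CK) (hδK : 0 < δK)
    (hS : ∀ κ u, BiLoc (S κ u) u u CS δS) (hCS : 0 ≤ CS) (hδS : 0 < δS)
    (ν κ' : Fin (d + 1)) (y' x z : Site (d + 1)) (a b : Fib d) :
    (∑' u : Site (d + 1), perZ M K u ((N : ℤ) • y') (Sum.inl κ') (Sum.inr ν) * S κ' u x z a b)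
      = ∑ u : ↥(pbox M), perZ M K (u : Site (d + 1)) ((N : ℤ) • y') (Sum.inl κ') (Sum.inr ν)
          * ∑' n : Site (d + 1), S κ' (translate M (u : Site (d + 1)) n) x z a b := by
  have hSu := abs_apply_le_of_biLoc S a b hS hCS hδS.le
  have hG : Summable fun u : Site (d + 1) => perZ M K u ((N : ℤ) • y') (Sum.inl κ') (Sum.inr ν) * S κ' u x z a b := by
    refine ((summable_exp_shift hδS x).mul_left (CK * latticeConst (d + 1) δK * CS)).of_norm_bounded fun u => ?_
    rw [Real.norm_eq_abs, abs_mul, show CK * latticeConst (d + 1) δK * CS * Real.exp (-δS * l1 (x - u))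
      = (CK * latticeConst (d + 1) δK) * (CS * Real.exp (-δS * l1 (x - u))) by ring]
    exact mul_le_mul (abs_perZ_le_of_decays M hK hCK hδK u _ _ _) (hSu κ' u x z) (abs_nonneg _)
      (mul_nonneg hCK (latticeConst_nonneg _ hδK.le))
  rw [tsum_sites_eq_sum_tsum M hG]
  refine Finset.sum_congr rfl fun u _ => ?_
  simp only [perZ_translate_left M hKinv]
  rw [tsum_mul_left]

/-- [folklore] **`tsum_vertexOfK_translate_apply` — THE SOURCE-WOUND CHAIN-RULE VERTEX IS THE FOLD THROUGH THE PERIODISED COLUMN** (no covariance of `S` needed;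
`K` period-invariant and decaying, `S` bond-localised): `Σ'_d vertexOfK K N S ν (y′ + M′∘d) x z a b
= Σ_{β ∈ pbox M × Fin (d+1)} (perF M K) ((β.1, inl β.2), (wrapPt M (N•y′), inr ν)) · Σ'_n S β.2 (β.1 + M∘n) x z a b`. -/
theorem tsum_vertexOfK_translate_apply (hM : ∀ i, M i = N * M' i)
    (hKinv : ∀ (m x z : Site (d + 1)) (a b : Fib d), K (translate M x m) (translate M z m) a b = K x z a b)
    {CK δK CS δS : ℝ} (hK : Decays K CK δK) (hCK : 0 ≤ CK) (hδK : 0 < δK)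
    (hS : ∀ κ u, BiLoc (S κ u) u u CS δS) (hCS : 0 ≤ CS) (hδS : 0 < δS)
    (ν : Fin (d + 1)) (y' x z : Site (d + 1)) (a b : Fib d) :
    ∑' dd : Site (d + 1), vertexOfK K N S ν (translate M' y' dd) x z a b
      = ∑ β : ↥(pbox M) × Fin (d + 1), perF M K (β.1, Sum.inl β.2) (wrapPt M ((N : ℤ) • y'), Sum.inr ν)
          * ∑' n : Site (d + 1), S β.2 (translate M (β.1 : Site (d + 1)) n) x z a b := by
  have h1 : ∀ dd : Site (d + 1), vertexOfK K N S ν (translate M' y' dd) x z a b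
      = ∑ κ' : Fin (d + 1), ∑' u : Site (d + 1), K (translate M u (-dd)) ((N : ℤ) • y') (Sum.inl κ') (Sum.inr ν) * S κ' u x z a b := fun dd => by
    rw [vertexOfK_apply]
    refine Finset.sum_congr rfl fun κ' _ => tsum_congr fun u => ?_
    rw [colH_translate_eq M hM hKinv]
  rw [tsum_congr h1, Summable.tsum_finsetSum (fun κ' _ => summable_tsum_col_translate_mul M hK hCK hδK hS hCS hδS ν κ' y' x z a b)]
  simp only [tsum_tsum_col_translate_mul M hKinv hK hCK hδK hS hCS hδS, tsum_perZ_mul_eq_sum_box M hKinv hK hCK hδK hS hCS hδS]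
  rw [Finset.sum_comm, Fintype.sum_prod_type]
  refine Finset.sum_congr rfl fun u _ => Finset.sum_congr rfl fun κ' _ => ?_
  rw [perZ_coarse_col_eq_perF M]

end OneSource


/-! ## §2 Two sources: the wound double fold -/

section TwoSources

open OneStepResolventKernel (biLoc_mono)
open SecondOrderResponse (biLoc_recenter_left biLoc_recenter_right)
open ExpKernelCalculus (Zl Zl_nonneg)

variable {S₂ : Fin (d + 1) → Site (d + 1) → Fin (d + 1) → Site (d + 1) → MKer (d + 1) (Fib d)}

omit [∀ μ, NeZero (M μ)] in
/-- [folklore] **the slice of a local bi-stencil family at a fixed FIRST bond is bond-localised in its SECOND bond** (rate halved): the separation factor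
`e^{−δ|u′−u|}` of lit `LocStencil₂` re-centres both legs from `u` to `u′` (`biLoc_recenter_left ∕ _right`). -/
theorem biLoc_slice {C δ : ℝ} (hS₂ : LocStencil₂ S₂ C δ) (hδ : 0 ≤ δ) (κ : Fin (d + 1)) (u : Site (d + 1)) (κ' : Fin (d + 1)) (u' : Site (d + 1)) :
    BiLoc (S₂ κ u κ' u') u' u' C (δ / 2) := by
  have hC := hS₂.nonneg
  have e : (C * Real.exp (-(δ / 2) * l1 (u' - u))) * Real.exp (-(δ / 2) * l1 (u' - u)) = C * Real.exp (-δ * l1 (u' - u)) := by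
    rw [mul_assoc, ← Real.exp_add, show -(δ / 2) * l1 (u' - u) + -(δ / 2) * l1 (u' - u) = -δ * l1 (u' - u) by ring]
  have h0 : BiLoc (S₂ κ u κ' u') u u ((C * Real.exp (-(δ / 2) * l1 (u' - u))) * Real.exp (-(δ / 2) * l1 (u' - u))) (δ / 2) := by
    rw [e]; exact biLoc_mono (hS₂ κ u κ' u') (mul_nonneg hC (Real.exp_pos _).le) (show δ / 2 ≤ δ by linarith)
  have h1 : BiLoc (S₂ κ u κ' u') u' u (C * Real.exp (-(δ / 2) * l1 (u' - u))) (δ / 2) :=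
    biLoc_recenter_left h0 (mul_nonneg hC (Real.exp_pos _).le) (by linarith) le_rfl
  exact biLoc_recenter_right h1 hC (by linarith) le_rfl

omit [∀ μ, NeZero (M μ)] in
/-- [folklore] **the second-bond-periodised slice family is PERIOD-COVARIANT in its first bond** (jointly with the lattice arguments) when `S₂` is jointly
period-covariant: `Σ'_n S₂ κ (u + M∘m) κ′ (u′ + M∘n) (x + M∘m) (z + M∘m) = Σ'_n S₂ κ u κ′ (u′ + M∘n) x z` (re-index `n ↦ n − m`). -/
theorem tsum_slice_translate
    (hS₂t : ∀ (κ : Fin (d + 1)) (u : Site (d + 1)) (κ' : Fin (d + 1)) (u' m x z : Site (d + 1)) (a b : Fib d),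
      S₂ κ (translate M u m) κ' (translate M u' m) (translate M x m) (translate M z m) a b = S₂ κ u κ' u' x z a b)
    (κ : Fin (d + 1)) (u : Site (d + 1)) (κ' : Fin (d + 1)) (u' m x z : Site (d + 1)) (a b : Fib d) :
    (∑' n : Site (d + 1), S₂ κ (translate M u m) κ' (translate M u' n) (translate M x m) (translate M z m) a b)
      = ∑' n : Site (d + 1), S₂ κ u κ' (translate M u' n) x z a b := by
  rw [← (Equiv.addRight m).tsum_eq fun n => S₂ κ (translate M u m) κ' (translate M u' n) (translate M x m) (translate M z m) a b]
  refine tsum_congr fun n => ?_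
  rw [Equiv.coe_addRight, ← translate_translate, hS₂t]

/-- [folklore] **the second-bond-periodised slice family is BOND-LOCALISED at its first bond** with constant `C·K_{d+1}(δ)`: the copies of the second bond sum a
geometric series of separation factors (`summable_exp_l1_translate`). -/
theorem biLoc_tsum_slice {C δ : ℝ} (hS₂ : LocStencil₂ S₂ C δ) (hδ : 0 < δ) (κ' : Fin (d + 1)) (u' : Site (d + 1)) (κ : Fin (d + 1)) (u : Site (d + 1)) :
    BiLoc (fun x z a b => ∑' n : Site (d + 1), S₂ κ u κ' (translate M u' n) x z a b) u u (C * latticeConst (d + 1) δ) δ := by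
  have hC := hS₂.nonneg
  intro x z a b
  obtain ⟨hs, hle⟩ := summable_exp_l1_translate M hδ u u'
  have hterm : ∀ n : Site (d + 1), ‖S₂ κ u κ' (translate M u' n) x z a b‖
      ≤ C * Real.exp (-δ * l1 (translate M u' n - u)) * Real.exp (-δ * (l1 (x - u) + l1 (z - u))) := fun n => by
    rw [Real.norm_eq_abs]; exact hS₂ κ u κ' (translate M u' n) x z a b
  have h1 := tsum_of_norm_bounded ((hs.mul_left C).mul_right (Real.exp (-δ * (l1 (x - u) + l1 (z - u))))).hasSum hterm
  refine ((Real.norm_eq_abs _).symm.trans_le h1).trans ?_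
  rw [tsum_mul_right, tsum_mul_left]
  exact mul_le_mul_of_nonneg_right (mul_le_mul_of_nonneg_left hle hC) (Real.exp_pos _).le

/-- [folklore] **`tsum_vertexOfK_slice_translate` — THE WOUND SLICE VERTEX**: for a local bi-stencil family, at a fixed first bond `(κ, u)`,
`Σ'_d vertexOfK K N (S₂ κ u) ν (y′ + M′∘d) x z a b = Σ_β (perF M K) ((β.1, inl β.2), (wrapPt M (N•y′), inr ν)) · Σ'_n S₂ κ u β.2 (β.1 + M∘n) x z a b` (§1 at the slice,
re-centred by `biLoc_slice`). -/
theorem tsum_vertexOfK_slice_translate (hM : ∀ i, M i = N * M' i)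
    (hKinv : ∀ (m x z : Site (d + 1)) (a b : Fib d), K (translate M x m) (translate M z m) a b = K x z a b)
    {CK δK C₂ δ₂ : ℝ} (hK : Decays K CK δK) (hCK : 0 ≤ CK) (hδK : 0 < δK) (hS₂ : LocStencil₂ S₂ C₂ δ₂) (hδ₂ : 0 < δ₂)
    (κ : Fin (d + 1)) (u : Site (d + 1)) (ν : Fin (d + 1)) (y' x z : Site (d + 1)) (a b : Fib d) :
    ∑' dd : Site (d + 1), vertexOfK K N (S₂ κ u) ν (translate M' y' dd) x z a b
      = ∑ β : ↥(pbox M) × Fin (d + 1), perF M K (β.1, Sum.inl β.2) (wrapPt M ((N : ℤ) • y'), Sum.inr ν)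
          * ∑' n : Site (d + 1), S₂ κ u β.2 (translate M (β.1 : Site (d + 1)) n) x z a b :=
  tsum_vertexOfK_translate_apply M hM hKinv hK hCK hδK (fun κ' u' => biLoc_slice hS₂ hδ₂.le κ u κ' u') hS₂.nonneg (half_pos hδ₂) ν y' x z a b

/-- [folklore] **`tsum_vertex2OfK_translate_apply` — THE WOUND DOUBLE VERTEX IS THE CHAIN-RULE VERTEX OVER THE WOUND SLICE VERTICES** (exchange of the winding sum
with the outer column sum; joint summability from lit `biLoc_vertexOfK_slice` — the slice vertex decays in `|u − N•(y′ + M′∘d)|` — and the chart's decay):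
`Σ'_d vertex2OfK K N S₂ μ y ν (y′ + M′∘d) x z a b = vertexOfK K N (κ u ↦ (x z a b ↦ Σ'_d vertexOfK K N (S₂ κ u) ν (y′ + M′∘d) x z a b)) μ y x z a b`. -/
theorem tsum_vertex2OfK_translate_apply (hM : ∀ i, M i = N * M' i)
    {CK δK C₂ : ℝ} (hK : Decays K CK δK) (hCK : 0 ≤ CK) (hδK : 0 < δK) (hS₂ : LocStencil₂ S₂ C₂ δK)
    (μ : Fin (d + 1)) (y : Site (d + 1)) (ν : Fin (d + 1)) (y' x z : Site (d + 1)) (a b : Fib d) :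
    ∑' dd : Site (d + 1), vertex2OfK K N S₂ μ y ν (translate M' y' dd) x z a b
      = vertexOfK K N (fun κ u => fun x z a b => ∑' dd : Site (d + 1), vertexOfK K N (S₂ κ u) ν (translate M' y' dd) x z a b) μ y x z a b := by
  have hC₂ := hS₂.nonneg
  -- the summand family and its bound
  have hF : ∀ (κ : Fin (d + 1)) (u dd : Site (d + 1)),
      |vertexOfK K N (S₂ κ u) ν (translate M' y' dd) x z a b|
        ≤ (((d + 1 : ℕ) : ℝ) * (CK * C₂ * Zl (d + 1) (δK / 2))) * Real.exp (-(δK / 2) * l1 (translate M u (-dd) - (N : ℤ) • y')) := fun κ u dd => by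
    have h := (biLoc_vertexOfK_slice (N := N) hK hCK hS₂ hδK κ u ν (translate M' y' dd)) x z a b
    refine h.trans ?_
    have he : Real.exp (-δK * (l1 (x - u) + l1 (z - u))) ≤ 1 := by
      rw [Real.exp_le_one_iff]
      exact mul_nonpos_of_nonpos_of_nonneg (neg_nonpos.mpr hδK.le) (add_nonneg (l1_nonneg _) (l1_nonneg _))
    have hl : l1 (u - (N : ℤ) • translate M' y' dd) = l1 (translate M u (-dd) - (N : ℤ) • y') := by
      rw [nsmul_translate hM]
      congr 1
      funext i; simp only [Pi.sub_apply, translate_apply, Pi.neg_apply]; ring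
    rw [hl]
    have h0 : 0 ≤ ((d + 1 : ℕ) : ℝ) * (CK * C₂ * Zl (d + 1) (δK / 2) * Real.exp (-(δK / 2) * l1 (translate M u (-dd) - (N : ℤ) • y'))) :=
      mul_nonneg (Nat.cast_nonneg _) (mul_nonneg (mul_nonneg (mul_nonneg hCK hC₂) (Zl_nonneg (half_pos hδK))) (Real.exp_pos _).le)
    calc ((d + 1 : ℕ) : ℝ) * (CK * C₂ * Zl (d + 1) (δK / 2) * Real.exp (-(δK / 2) * l1 (translate M u (-dd) - (N : ℤ) • y')))
          * Real.exp (-δK * (l1 (x - u) + l1 (z - u)))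
        ≤ ((d + 1 : ℕ) : ℝ) * (CK * C₂ * Zl (d + 1) (δK / 2) * Real.exp (-(δK / 2) * l1 (translate M u (-dd) - (N : ℤ) • y'))) * 1 :=
          mul_le_mul_of_nonneg_left he h0
      _ = (((d + 1 : ℕ) : ℝ) * (CK * C₂ * Zl (d + 1) (δK / 2))) * Real.exp (-(δK / 2) * l1 (translate M u (-dd) - (N : ℤ) • y')) := by ring
  -- joint summability of the column weight times the wound slice vertex, per fibre index
  have hCst0 : 0 ≤ ((d + 1 : ℕ) : ℝ) * (CK * C₂ * Zl (d + 1) (δK / 2)) :=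
    mul_nonneg (Nat.cast_nonneg _) (mul_nonneg (mul_nonneg hCK hC₂) (Zl_nonneg (half_pos hδK)))
  have hsum : ∀ κ : Fin (d + 1), Summable (Function.uncurry fun u n : Site (d + 1) =>
      K u ((N : ℤ) • y) (Sum.inl κ) (Sum.inr μ) * vertexOfK K N (S₂ κ u) ν (translate M' y' (-n)) x z a b) := fun κ => by
    refine summable_of_translate_bound M (C := CK * (((d + 1 : ℕ) : ℝ) * (CK * C₂ * Zl (d + 1) (δK / 2))))
      (mul_nonneg hCK hCst0) (half_pos hδK) hδK ((N : ℤ) • y') ((N : ℤ) • y) fun u n => ?_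
    rw [Function.uncurry_apply_pair, abs_mul]
    have h1 := hK u ((N : ℤ) • y) (Sum.inl κ) (Sum.inr μ)
    have h2 := hF κ u (-n)
    rw [neg_neg] at h2
    calc |K u ((N : ℤ) • y) (Sum.inl κ) (Sum.inr μ)| * |vertexOfK K N (S₂ κ u) ν (translate M' y' (-n)) x z a b|
        ≤ (CK * Real.exp (-δK * l1 (u - (N : ℤ) • y)))
            * ((((d + 1 : ℕ) : ℝ) * (CK * C₂ * Zl (d + 1) (δK / 2))) * Real.exp (-(δK / 2) * l1 (translate M u n - (N : ℤ) • y'))) :=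
          mul_le_mul h1 h2 (abs_nonneg _) (mul_nonneg hCK (Real.exp_pos _).le)
      _ = CK * (((d + 1 : ℕ) : ℝ) * (CK * C₂ * Zl (d + 1) (δK / 2))) * Real.exp (-(δK / 2) * l1 (translate M u n - (N : ℤ) • y'))
            * Real.exp (-δK * l1 ((N : ℤ) • y - u)) := by rw [l1_sub_symm u]; ring
  -- exchange the winding sum with the outer (finite fibre × lattice) sum
  rw [vertexOfK_apply]
  simp only [vertex2OfK, vertexOfK_apply K N (fun κ u => vertexOfK K N (S₂ κ u) ν _) μ y]
  have hn : ∀ κ ∈ (Finset.univ : Finset (Fin (d + 1))), Summable fun dd : Site (d + 1) =>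
      ∑' u : Site (d + 1), K u ((N : ℤ) • y) (Sum.inl κ) (Sum.inr μ) * vertexOfK K N (S₂ κ u) ν (translate M' y' dd) x z a b := fun κ _ =>
    (Equiv.neg (Site (d + 1))).summable_iff.1 ((hsum κ).prod_symm.prod)
  rw [Summable.tsum_finsetSum hn]
  refine Finset.sum_congr rfl fun κ _ => ?_
  have hx := (hsum κ).tsum_comm
  -- `hx : Σ' n, Σ' u, f u n = Σ' u, Σ' n, f u n` with `f u n` at winding `-n`; re-index `n ↦ -n` on both sides
  rw [← (Equiv.neg (Site (d + 1))).tsum_eq fun dd => ∑' u : Site (d + 1),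
    K u ((N : ℤ) • y) (Sum.inl κ) (Sum.inr μ) * vertexOfK K N (S₂ κ u) ν (translate M' y' dd) x z a b]
  simp only [Equiv.neg_apply]
  rw [hx]
  refine tsum_congr fun u => ?_
  rw [← tsum_mul_left]
  exact ((Equiv.neg (Site (d + 1))).tsum_eq fun dd =>
    K u ((N : ℤ) • y) (Sum.inl κ) (Sum.inr μ) * vertexOfK K N (S₂ κ u) ν (translate M' y' dd) x z a b)

end TwoSources


end Summit.QuantumFields.BalabanUV.Beta.NVertexWoundFold

end
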